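import Mathlib
import HarnessLib
import Summits.Ventures.LatticeQCDFlow.Exactness.IMHKernel

/-!
# LatticeQCDFlow / Exactness — LEARNING ON THE JOB, II: THE LEAVE-ONE-OUT RULE — a population of walkers in which each walker's flow is
# fitted to the OTHER walkers is exact on the product space when the walkers are updated one block at a time

HONEST FRAMING: exact (Metropolis-corrected) sampling algorithms for lattice gauge theory;
figures of merit are autocorrelation/cost numbers at stated couplings and volumes; no
continuum-physics claim.

Venture `LatticeQCDFlow` (cell pub-lqcd), topic `Exactness`, FANOUT row 30 (lean-1 GEN-44, theme LEARNING ON THE JOB — adaptive,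
pilot-trained and population flow proposals on a general state space).  NEW WORK of the cell over Mathlib (`Measure.prod`, Tonelli,
`Kernel.Invariant.comp`) and the tree's `IMHKernel`; no definition is introduced, nothing is cited as a fact.  Printed counterparts NAMED
ONLY: ensemble ∕ population MCMC with walker-conditional proposals (Gilks–Roberts–George adaptive direction sampling 1994; Goodman–Weare
2010 and its two-half parallel update; population-trained normalizing-flow proposals, Gabrié–Rotskoff–Vanden-Eijnden 2022).

## Setting
Two blocks: a walker with state space `Ω` and target `π`, and "the rest of the population" with state space `Ω'` and target `π'` (itself a
product of walkers, or anything); the population target is `π ⊗ π'`.  The walker's update is PARAMETRISED BY THE REST: a kernel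
`κ : Kernel (Ω' × Ω) Ω`, `κ(x', x)` = the law of the walker's next state when the rest sits at `x'` — e.g. the flow sampler whose flow was
fitted to the other walkers (`indepMH (q x') (w x')`, §3).  THE LEAVE-ONE-OUT HYPOTHESIS (`hκ`): every frozen-rest section is exact for
`π`, `∫ κ(x', x)(B) π(dx) = π(B)` for all `x'`.  Symmetrically `κ' : Kernel (Ω × Ω') Ω'` updates the rest reading the walker (`hκ'`).
DEF-FREE half-sweeps on `Ω × Ω'`: `T₁(x, x')(C) = κ(x', x){y | (y, x') ∈ C}` (move the walker, freeze the rest), `T₂(x, x')(C) =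
κ'(x, x'){y' | (x, y') ∈ C}` (move the rest, freeze the walker) — hypotheses `hT₁`, `hT₂` on arbitrary kernels.

## Results (no `sorry`)
* §1 **`leaveOneOut_fst_invariant`** ∕ **`leaveOneOut_snd_invariant`** — each half-sweep leaves `π ⊗ π'` invariant (Tonelli + the section
  hypothesis + `Measure.prod_apply(_symm)`): updating ONE block with a kernel fitted to the OTHER blocks, frozen, is exact on the product.
* §2 **`leaveOneOut_sequential_invariant`** — the SEQUENTIAL sweep `T₂ ∘ₖ T₁` (walker first, then the rest reading the walker's NEW state)
  leaves `π ⊗ π'` invariant; `leaveOneOut_sequential_invariant'` — def-free form for any kernel `S` with `S(p, C) = ∫ T₂(m, C) T₁(p, dm)`;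
  `leaveOneOut_sequential_invariant_symm` — the other order.  By induction over blocks (the tree's `invariant_cycle`) a full sweep of a
  population of any size, each walker proposed from a flow fitted to the others AT THE TIME OF ITS UPDATE, is exact; so is the two-half
  scheme (update all of half A in parallel reading half B only, then half B reading the new half A): take `Ω` = half A.
* §3 THE FLOW INSTANCE (`leaveOneOut_imh_sections_exact`): if the fitted flows form a measurable family `q : Kernel Ω' Ω` with jointly
  measurable positive weights `w(x', ·)` and `w(x', ·)·q(x') = π` for every `x'` (each fitted flow is paired with ITS OWN importance
  weight against the fixed target), then any `κ` realising `indepMH (q x') (w x')` section-wise satisfies the leave-one-out hypothesis;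
  **`leaveOneOut_imh_fst_invariant`** — hence the population flow sampler's half-sweep is exact.
* §4 `leaveOneOut_fst_isMarkovKernel` ∕ `leaveOneOut_fst_exists` — bookkeeping: the half-sweep is Markov and is realised by
  `(κ.comap swap) ×ₖ (deterministic snd)`.
NOT here: the SIMULTANEOUS update of all walkers, each reading the others' CURRENT states — it is NOT exact (`PopulationSimultaneousBias`,
two-walker witness), unless the information flows one way only.
-/

namespace Summit.Ventures.LatticeQCDFlow.Exactness

open MeasureTheory ProbabilityTheory
open scoped ENNReal

variable {Ω Ω' : Type*} [MeasurableSpace Ω] [MeasurableSpace Ω'] {π : Measure Ω} {π' : Measure Ω'}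

/-! ## §1 Half-sweeps: move one block with a kernel fitted to the other, frozen -/

/-- **THE LEAVE-ONE-OUT HALF-SWEEP IS EXACT (walker block)**: if every frozen-rest section of `κ` is exact for `π`, then ANY kernel `T₁`
on `Ω × Ω'` with `T₁(x, x')(C) = κ(x', x){y | (y, x') ∈ C}` leaves `π ⊗ π'` invariant. [ours] -/
theorem leaveOneOut_fst_invariant [SFinite π] [SFinite π'] (κ : Kernel (Ω' × Ω) Ω)
    (hκ : ∀ (x' : Ω') {B : Set Ω}, MeasurableSet B → ∫⁻ x, κ (x', x) B ∂π = π B) (T₁ : Kernel (Ω × Ω') (Ω × Ω'))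
    (hT₁ : ∀ (x : Ω) (x' : Ω') {C : Set (Ω × Ω')}, MeasurableSet C → T₁ (x, x') C = κ (x', x) ((fun y => (y, x')) ⁻¹' C)) :
    Kernel.Invariant T₁ (π.prod π') := by
  show (π.prod π').bind T₁ = π.prod π'
  ext C hC
  rw [Measure.bind_apply hC (Kernel.aemeasurable _), lintegral_prod_symm _ (Kernel.measurable_coe T₁ hC).aemeasurable]
  simp_rw [hT₁ _ _ hC]
  have hsec : ∀ x', ∫⁻ x, κ (x', x) ((fun y => (y, x')) ⁻¹' C) ∂π = π ((fun y => (y, x')) ⁻¹' C) :=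
    fun x' => hκ x' (measurable_prodMk_right hC)
  simp_rw [hsec]
  rw [Measure.prod_apply_symm hC]

/-- **THE LEAVE-ONE-OUT HALF-SWEEP IS EXACT (rest block)**: symmetrically for `T₂(x, x')(C) = κ'(x, x'){y' | (x, y') ∈ C}`. [ours] -/
theorem leaveOneOut_snd_invariant [SFinite π'] (κ' : Kernel (Ω × Ω') Ω')
    (hκ' : ∀ (x : Ω) {B' : Set Ω'}, MeasurableSet B' → ∫⁻ x', κ' (x, x') B' ∂π' = π' B') (T₂ : Kernel (Ω × Ω') (Ω × Ω'))
    (hT₂ : ∀ (x : Ω) (x' : Ω') {C : Set (Ω × Ω')}, MeasurableSet C → T₂ (x, x') C = κ' (x, x') ((fun y' => (x, y')) ⁻¹' C)) :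
    Kernel.Invariant T₂ (π.prod π') := by
  show (π.prod π').bind T₂ = π.prod π'
  ext C hC
  rw [Measure.bind_apply hC (Kernel.aemeasurable _), lintegral_prod _ (Kernel.measurable_coe T₂ hC).aemeasurable]
  simp_rw [hT₂ _ _ hC]
  have hsec : ∀ x, ∫⁻ x', κ' (x, x') ((fun y' => (x, y')) ⁻¹' C) ∂π' = π' ((fun y' => (x, y')) ⁻¹' C) :=
    fun x => hκ' x (measurable_prodMk_left hC)
  simp_rw [hsec]
  rw [Measure.prod_apply hC]

/-! ## §2 The sequential sweep -/

/-- **THE SEQUENTIAL LEAVE-ONE-OUT SWEEP IS EXACT**: update the walker from a kernel fitted to the rest, THEN the rest from a kernel fitted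
to the walker's new state — `T₂ ∘ₖ T₁` leaves `π ⊗ π'` invariant. [ours] -/
theorem leaveOneOut_sequential_invariant [SFinite π] [SFinite π'] (κ : Kernel (Ω' × Ω) Ω) (κ' : Kernel (Ω × Ω') Ω')
    (hκ : ∀ (x' : Ω') {B : Set Ω}, MeasurableSet B → ∫⁻ x, κ (x', x) B ∂π = π B)
    (hκ' : ∀ (x : Ω) {B' : Set Ω'}, MeasurableSet B' → ∫⁻ x', κ' (x, x') B' ∂π' = π' B')
    (T₁ T₂ : Kernel (Ω × Ω') (Ω × Ω'))
    (hT₁ : ∀ (x : Ω) (x' : Ω') {C : Set (Ω × Ω')}, MeasurableSet C → T₁ (x, x') C = κ (x', x) ((fun y => (y, x')) ⁻¹' C))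
    (hT₂ : ∀ (x : Ω) (x' : Ω') {C : Set (Ω × Ω')}, MeasurableSet C → T₂ (x, x') C = κ' (x, x') ((fun y' => (x, y')) ⁻¹' C)) :
    Kernel.Invariant (T₂ ∘ₖ T₁) (π.prod π') :=
  (leaveOneOut_snd_invariant κ' hκ' T₂ hT₂).comp (leaveOneOut_fst_invariant κ hκ T₁ hT₁)

/-- … def-free: ANY kernel `S` with `S(p, C) = ∫ T₂(m, C) T₁(p, dm)` (first the walker, then the rest) leaves `π ⊗ π'` invariant. [ours] -/
theorem leaveOneOut_sequential_invariant' [SFinite π] [SFinite π'] (κ : Kernel (Ω' × Ω) Ω) (κ' : Kernel (Ω × Ω') Ω')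
    (hκ : ∀ (x' : Ω') {B : Set Ω}, MeasurableSet B → ∫⁻ x, κ (x', x) B ∂π = π B)
    (hκ' : ∀ (x : Ω) {B' : Set Ω'}, MeasurableSet B' → ∫⁻ x', κ' (x, x') B' ∂π' = π' B')
    (T₁ T₂ S : Kernel (Ω × Ω') (Ω × Ω'))
    (hT₁ : ∀ (x : Ω) (x' : Ω') {C : Set (Ω × Ω')}, MeasurableSet C → T₁ (x, x') C = κ (x', x) ((fun y => (y, x')) ⁻¹' C))
    (hT₂ : ∀ (x : Ω) (x' : Ω') {C : Set (Ω × Ω')}, MeasurableSet C → T₂ (x, x') C = κ' (x, x') ((fun y' => (x, y')) ⁻¹' C))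
    (hS : ∀ (p : Ω × Ω') {C : Set (Ω × Ω')}, MeasurableSet C → S p C = ∫⁻ m, T₂ m C ∂(T₁ p)) :
    Kernel.Invariant S (π.prod π') := by
  have hSe : S = T₂ ∘ₖ T₁ := by
    ext p C hC
    rw [hS p hC, Kernel.comp_apply' _ _ _ hC]
  rw [hSe]
  exact leaveOneOut_sequential_invariant κ κ' hκ hκ' T₁ T₂ hT₁ hT₂

/-- … and in the other order (rest first, then the walker reading the rest's new state). [ours] -/
theorem leaveOneOut_sequential_invariant_symm [SFinite π] [SFinite π'] (κ : Kernel (Ω' × Ω) Ω) (κ' : Kernel (Ω × Ω') Ω')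
    (hκ : ∀ (x' : Ω') {B : Set Ω}, MeasurableSet B → ∫⁻ x, κ (x', x) B ∂π = π B)
    (hκ' : ∀ (x : Ω) {B' : Set Ω'}, MeasurableSet B' → ∫⁻ x', κ' (x, x') B' ∂π' = π' B')
    (T₁ T₂ : Kernel (Ω × Ω') (Ω × Ω'))
    (hT₁ : ∀ (x : Ω) (x' : Ω') {C : Set (Ω × Ω')}, MeasurableSet C → T₁ (x, x') C = κ (x', x) ((fun y => (y, x')) ⁻¹' C))
    (hT₂ : ∀ (x : Ω) (x' : Ω') {C : Set (Ω × Ω')}, MeasurableSet C → T₂ (x, x') C = κ' (x, x') ((fun y' => (x, y')) ⁻¹' C)) :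
    Kernel.Invariant (T₁ ∘ₖ T₂) (π.prod π') :=
  (leaveOneOut_fst_invariant κ hκ T₁ hT₁).comp (leaveOneOut_snd_invariant κ' hκ' T₂ hT₂)

/-! ## §3 The flow instance: each walker proposed from a flow fitted to the others, with that flow's own importance weight -/

section Flow

variable (q : Kernel Ω' Ω) [IsMarkovKernel q] {w : Ω' → Ω → ℝ}

/-- **THE FITTED-FLOW SECTIONS ARE EXACT**: if for every configuration `x'` of the rest the fitted flow `q(x')` and its weight `w(x', ·) > 0`
satisfy `w(x', ·)·q(x') = π`, then every kernel realising `indepMH (q x') (w x')` section-wise satisfies the leave-one-out hypothesis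
`∫ κ(x', x)(B) π(dx) = π(B)`. [ours] -/
theorem leaveOneOut_imh_sections_exact (hw : ∀ x', Measurable (w x')) (hw0 : ∀ x' y, 0 < w x' y)
    (hπ : ∀ x', ((q x').withDensity fun y => ENNReal.ofReal (w x' y)) = π) (κ : Kernel (Ω' × Ω) Ω)
    (hκ : ∀ (x' : Ω') (x : Ω) {B : Set Ω}, MeasurableSet B → κ (x', x) B =
      ∫⁻ y in B, imhAcceptE (w x') x y ∂(q x') + (1 - imhAcceptMass (q x') (w x') x) * B.indicator 1 x)
    (x' : Ω') {B : Set Ω} (hB : MeasurableSet B) : ∫⁻ x, κ (x', x) B ∂π = π B := by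
  have hsec : ∀ x, κ (x', x) B = indepMH (q x') (w x') x B := fun x => by
    rw [hκ x' x hB, indepMH_apply (hw x') x hB]
  simp_rw [hsec]
  have hinv := (indepMH_invariant (q := q x') (hw x') (hw0 x')).def
  rw [hπ x'] at hinv
  have := congrArg (fun μ : Measure Ω => μ B) hinv
  simpa only [Measure.bind_apply hB (Kernel.aemeasurable _)] using this

/-- **THE POPULATION FLOW SAMPLER'S HALF-SWEEP IS EXACT**: proposing the walker from the flow fitted to the rest of the population (frozen
during the update), accepted with that flow's importance ratio, leaves `π ⊗ π'` invariant — for every measurable family of fitted flows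
paired with their own weights. [ours] -/
theorem leaveOneOut_imh_fst_invariant [SFinite π] [SFinite π'] (hw : ∀ x', Measurable (w x')) (hw0 : ∀ x' y, 0 < w x' y)
    (hπ : ∀ x', ((q x').withDensity fun y => ENNReal.ofReal (w x' y)) = π) (κ : Kernel (Ω' × Ω) Ω)
    (hκ : ∀ (x' : Ω') (x : Ω) {B : Set Ω}, MeasurableSet B → κ (x', x) B =
      ∫⁻ y in B, imhAcceptE (w x') x y ∂(q x') + (1 - imhAcceptMass (q x') (w x') x) * B.indicator 1 x)
    (T₁ : Kernel (Ω × Ω') (Ω × Ω'))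
    (hT₁ : ∀ (x : Ω) (x' : Ω') {C : Set (Ω × Ω')}, MeasurableSet C → T₁ (x, x') C = κ (x', x) ((fun y => (y, x')) ⁻¹' C)) :
    Kernel.Invariant T₁ (π.prod π') :=
  leaveOneOut_fst_invariant κ (fun x' _ hB => leaveOneOut_imh_sections_exact q hw hw0 hπ κ hκ x' hB) T₁ hT₁

end Flow

/-! ## §4 Bookkeeping: the half-sweep is Markov and exists -/

/-- The walker half-sweep is Markov when `κ` is. [ours, bookkeeping] -/
theorem leaveOneOut_fst_isMarkovKernel (κ : Kernel (Ω' × Ω) Ω) [IsMarkovKernel κ] (T₁ : Kernel (Ω × Ω') (Ω × Ω'))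
    (hT₁ : ∀ (x : Ω) (x' : Ω') {C : Set (Ω × Ω')}, MeasurableSet C → T₁ (x, x') C = κ (x', x) ((fun y => (y, x')) ⁻¹' C)) :
    IsMarkovKernel T₁ := by
  refine ⟨fun p => ⟨?_⟩⟩
  obtain ⟨x, x'⟩ := p
  rw [hT₁ x x' MeasurableSet.univ, Set.preimage_univ, measure_univ]

/-- The hypothesis `hT₁` is not vacuous: the product of `κ ∘ swap` with the deterministic copy of the rest realises it.
[ours, bookkeeping] -/
theorem leaveOneOut_fst_exists (κ : Kernel (Ω' × Ω) Ω) [IsMarkovKernel κ] :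
    ∃ T₁ : Kernel (Ω × Ω') (Ω × Ω'), ∀ (x : Ω) (x' : Ω') {C : Set (Ω × Ω')}, MeasurableSet C →
      T₁ (x, x') C = κ (x', x) ((fun y => (y, x')) ⁻¹' C) := by
  refine ⟨(κ.comap Prod.swap measurable_swap) ×ₖ (Kernel.deterministic Prod.snd measurable_snd), fun x x' C hC => ?_⟩
  rw [Kernel.prod_apply' _ _ _ hC, Kernel.comap_apply, Prod.swap_prod_mk, Kernel.deterministic_apply]
  have h : ∀ y : Ω, (Measure.dirac x') (Prod.mk y ⁻¹' C) = ((fun y => (y, x')) ⁻¹' C).indicator 1 y := by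
    intro y
    by_cases hy : (y, x') ∈ C
    · rw [Measure.dirac_apply_of_mem (show x' ∈ Prod.mk y ⁻¹' C from hy),
        Set.indicator_of_mem (show y ∈ (fun y => (y, x')) ⁻¹' C from hy), Pi.one_apply]
    · rw [Measure.dirac_apply' _ (measurable_prodMk_left hC), Set.indicator_of_notMem (show x' ∉ Prod.mk y ⁻¹' C from hy),
        Set.indicator_of_notMem (show y ∉ (fun y => (y, x')) ⁻¹' C from hy)]
  simp_rw [h]
  rw [lintegral_indicator_one (measurable_prodMk_right hC)]

end Summit.Ventures.LatticeQCDFlow.Exactness
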